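import Literature.Computability.AlgebraicComplexity.TableauScaling
import Literature.Computability.AlgebraicComplexity.OrbitClosureWeights
import Literature.NumberTheory.DiophantineGeometry.GLHighestWeight
import Mathlib.Algebra.MvPolynomial.Funext
import HarnessLib

/-!
# The tableau polynomial is a highest-weight vector of the coordinate ring of `Sym^m`

Mathematical layer of the Lean checker of the GCT multiplicity-obstruction engine (cell `pub-gct`;
honest framing: rung-1 multiplicity-obstruction search for permanent versus determinant at small
`(n, m)`, no claim about VP ≠ VNP or P ≠ NP), step H1c (second half): for a tableau datum `τ`
whose column alternators sit on the largest variables of an antitone enumeration `x` of the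
linearly ordered variable type `σ`, the tableau polynomial `τ.tabPoly K` (`TableauPolynomial.lean`)
lies in `highestWeightSpace (coordRep σ K m) χ` (tree: `GLHighestWeight.lean`,
`OrbitCoordinateRing.lean`) for the weight `χ (x i) = -#{c | i < h c} = -λ_i` — i.e. it is a
`B`-semi-invariant for the UPPER triangular Borel under the contragredient action
`(g · F)(q) = F(g⁻¹ · q)`, of weight `λ^*` (`TabM.tabPoly_mem_highestWeightSpace`).

Proof: two polynomial functions on `Sym^m` over an infinite field agree iff they agree at every
form (`MvPolynomial.funext`; every coefficient vector is `formCoeff` of the form `∑_d c_d x^d`,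
which has the monomial presentation `monoPres` as a sum of products of coordinate linear forms);
`(g · F_τ)(q) = F_τ(g⁻¹ q)` (tree: `aeval_formCoeff_coordSubst`) `= EC(g⁻¹ · pres q)`
(`aeval_formCoeff_tabPoly`, `linSubst_splfPoly`) `= θ(g⁻¹) EC(pres q)` (`EC_mapForms`, `g⁻¹`
upper triangular) and `θ(g⁻¹) = ∏_i (g⁻¹)_{x_i x_i}^{λ_i} = weightChar χ g`
(`theta_inv_eq_weightChar`, with the tree's `inv_apply_diag_of_isUpperTriangular'`). Dörfler–Ikenmeyer–Panova 2020 §5; Bürgisser–Ikenmeyer 2011/2013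
(highest-weight vectors from column alternators); hwv `FORMAT.md` §2 (U), (W). [folklore]
-/

noncomputable section

open scoped BigOperators

namespace Literature.Computability.AlgebraicComplexity

namespace TableauEval

open MvPolynomial
open _root_.Literature.NumberTheory.DiophantineGeometry

/- `DecidableEq σ` is taken from `LinearOrder σ` throughout (as in the tree's `GLHighestWeight`),
so that `GL σ k`, `DegIdx σ m` and `coordRep σ k m` carry the same instances as there. -/
variable {σ : Type*} [Fintype σ] [LinearOrder σ] {K : Type*} [CommRing K]

/-! ## §1 Every coefficient vector is a form with a monomial presentation -/

omit [Fintype σ] [LinearOrder σ] in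
/-- Every exponent vector of degree `n` is the content of an `n`-letter word. [folklore] -/
theorem exists_word_of_degree : ∀ (n : ℕ) (d : σ →₀ ℕ), d.degree = n →
    ∃ w : Fin n → σ, wordContent w = d
  | 0, d, hd => by
    refine ⟨Fin.elim0, ?_⟩
    rw [(Finsupp.degree_eq_zero_iff d).mp hd]
    simp [wordContent]
  | n + 1, d, hd => by
    have hd0 : d ≠ 0 := by
      intro h; rw [h, map_zero] at hd; exact Nat.succ_ne_zero n hd.symm
    obtain ⟨v, hv⟩ := Finsupp.support_nonempty_iff.mpr hd0
    have hv1 : Finsupp.single v 1 ≤ d :=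
      Finsupp.single_le_iff.mpr (Nat.one_le_iff_ne_zero.mpr (Finsupp.mem_support_iff.mp hv))
    have hsplit : d - Finsupp.single v 1 + Finsupp.single v 1 = d := tsub_add_cancel_of_le hv1
    have hdeg : (d - Finsupp.single v 1).degree = n := by
      have h := congrArg Finsupp.degree hsplit
      rw [map_add, Finsupp.degree_single, hd] at h
      omega
    obtain ⟨w', hw'⟩ := exists_word_of_degree n _ hdeg
    refine ⟨Fin.cons v w', ?_⟩
    rw [wordContent, Fin.sum_univ_succ, Fin.cons_zero]
    simp only [Fin.cons_succ]
    change Finsupp.single v 1 + wordContent w' = d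
    rw [hw', add_comm, hsplit]

/-- A chosen word of content `d` for a degree-`m` monomial index `d`. [folklore] -/
def wordOfIdx {m : ℕ} (d : DegIdx σ m) : Fin m → σ :=
  (exists_word_of_degree m d.1 (mem_degMonomials_iff.mp d.2)).choose

/-- The chosen word has content `d`. [folklore] -/
theorem wordContent_wordOfIdx {m : ℕ} (d : DegIdx σ m) : wordContent (wordOfIdx d) = d.1 :=
  (exists_word_of_degree m d.1 (mem_degMonomials_iff.mp d.2)).choose_spec

/-- The form with coefficient vector `c`: `∑_d c_d x^d`. [folklore] -/
def formOf {m : ℕ} (c : DegIdx σ m → K) : MvPolynomial σ K := ∑ d, monomial d.1 (c d)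

/-- Its degree-`m` coefficient vector is `c`. [folklore] -/
theorem formCoeff_formOf {m : ℕ} (c : DegIdx σ m → K) : formCoeff m (formOf c) = c := by
  funext d
  rw [formCoeff_apply, formOf, coeff_sum, Finset.sum_eq_single d]
  · rw [coeff_monomial, if_pos rfl]
  · intro d' _ hne
    rw [coeff_monomial, if_neg (fun h => hne (Subtype.ext h))]
  · intro h; exact absurd (Finset.mem_univ d) h

/-- The linear form of a coordinate vector `e_v` is the variable `X v`. [folklore] -/
theorem linForm_single (v : σ) : linForm (Pi.single v (1 : K)) = X v := by
  unfold linForm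
  rw [Finset.sum_eq_single v]
  · rw [Pi.single_eq_same, C_1, one_mul]
  · intro u _ hu; rw [Pi.single_eq_of_ne hu, C_0, zero_mul]
  · intro h; exact absurd (Finset.mem_univ v) h

omit [Fintype σ] [LinearOrder σ] in
/-- A product of variables along a word is the monomial of its content. [folklore] -/
theorem prod_X_word {m : ℕ} (w : Fin m → σ) : ∏ s, X (w s) = (monomial (wordContent w) (1 : K)) := by
  rw [wordContent, monomial_sum_one]
  rfl

/-- **Monomial presentation** of `∑_d c_d x^d` as a sum of products of coordinate linear forms:
term `t ↦ d = e t`, coefficient `c_d`, forms `e_{w_d s}` along a word `w_d` of content `d`.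
[folklore] -/
def monoPresCoef {m : ℕ} (c : DegIdx σ m → K) : Fin (Fintype.card (DegIdx σ m)) → K :=
  fun t => c ((Fintype.equivFin (DegIdx σ m)).symm t)

variable (σ K) in
/-- The forms of the monomial presentation (coordinate vectors along the chosen words; they do
not depend on the coefficients). [folklore] -/
def monoPresForm (m : ℕ) : Fin (Fintype.card (DegIdx σ m)) → Fin m → σ → K :=
  fun t s => Pi.single (wordOfIdx ((Fintype.equivFin (DegIdx σ m)).symm t) s) 1

/-- The monomial presentation presents `formOf c`. [folklore] -/
theorem splfPoly_monoPres {m : ℕ} (c : DegIdx σ m → K) :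
    splfPoly (monoPresCoef c) (monoPresForm σ K m) = formOf c := by
  unfold splfPoly monoPresCoef monoPresForm formOf
  simp only [linForm_single, prod_X_word, wordContent_wordOfIdx, C_mul_monomial, mul_one]
  exact Equiv.sum_comp (Fintype.equivFin (DegIdx σ m)).symm (fun d => monomial d.1 (c d))

/-! ## §2 The weight -/

section Weight

variable {k : Type*} [Field k]

/-- The scaling factor `θ(B) = ∏_c ∏_{i < h c} B (x i) (x i)` of `EC_mapForms`, regrouped by
variables: `∏_{i<N} B(x i, x i)^{#{c | i < h c}}`. [folklore] -/
theorem theta_eq_prod_pow {C N : ℕ} (h : Fin C → ℕ) (hh : ∀ c, h c ≤ N) (f : ℕ → k) :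
    (∏ c, ∏ i : Fin (h c), f i) =
      ∏ i ∈ Finset.range N, f i ^ (Finset.univ.filter fun c => i < h c).card := by
  have h1 : ∀ c, (∏ i : Fin (h c), f i) =
      ∏ i ∈ Finset.range N, (if i < h c then f i else 1) := by
    intro c
    rw [Fin.prod_univ_eq_prod_range (f := f), ← Finset.prod_filter]
    congr 1
    ext i
    simp only [Finset.mem_range, Finset.mem_filter]
    constructor
    · intro hi; exact ⟨lt_of_lt_of_le hi (hh c), hi⟩
    · intro hi; exact hi.2
  simp only [h1]
  rw [Finset.prod_comm]
  refine Finset.prod_congr rfl fun i _ => ?_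
  rw [← Finset.prod_filter, Finset.prod_const]

/-- **`θ(g⁻¹)` is the weight character**: for an antitone enumeration `x` of `σ`, an upper
triangular `g`, and the weight `χ (x i) = -#{c | i < h c}`,
`∏_c ∏_{i<h c} (g⁻¹)(x i, x i) = weightChar χ g`. [folklore] -/
theorem theta_inv_eq_weightChar {C N : ℕ} (h : Fin C → ℕ) (hh : ∀ c, h c ≤ N) {x : ℕ → σ}
    (hx : IsAntitoneEnum x N) (χ : Weight σ)
    (hχ : ∀ i < N, χ (x i) = -((Finset.univ.filter fun c => i < h c).card : ℤ))
    {g : GL σ k} (hg : IsUpperTriangular g) :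
    (∏ c, ∏ i : Fin (h c), ((g⁻¹ : GL σ k) : Matrix σ σ k) (x i) (x i)) = weightChar χ g := by
  rw [theta_eq_prod_pow h hh fun j => ((g⁻¹ : GL σ k) : Matrix σ σ k) (x j) (x j)]
  unfold weightChar
  -- reindex the product over `σ` by the enumeration `x`
  symm
  refine Finset.prod_nbij' (fun v => (hx.surj v).choose) x ?_ ?_ ?_ ?_ ?_
  · intro v _; exact Finset.mem_range.mpr (hx.surj v).choose_spec.1
  · intro i _; exact Finset.mem_univ _
  · intro v _; exact (hx.surj v).choose_spec.2
  · intro i hi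
    exact hx.inj (hx.surj (x i)).choose_spec.1 (Finset.mem_range.mp hi)
      (hx.surj (x i)).choose_spec.2
  · intro v _
    have hi := (hx.surj v).choose_spec
    set i := (hx.surj v).choose with hi_def
    rw [← hi.2, hχ i hi.1, zpow_neg, zpow_natCast, inv_apply_diag_of_isUpperTriangular' hg, inv_pow]

end Weight

/-! ## §3 The highest-weight property -/

namespace TabM

variable {k : Type} [Field k] [Infinite k] (τ : TabM σ)

/-- **The tableau polynomial is a highest-weight vector.** If the column alternators of `τ` sit
on the largest variables `x 0 > x 1 > ⋯` (`var c r = x r`, `x` an antitone enumeration of `σ`,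
`h c ≤ N`) and `χ (x i) = -#{c | i < h c}` (the dual weight `λ^*` of the shape), then
`τ.tabPoly k ∈ highestWeightSpace (coordRep σ k τ.m) χ`. [folklore] -/
theorem tabPoly_mem_highestWeightSpace (F : τ.Frame) {x : ℕ → σ} {N : ℕ} (hx : IsAntitoneEnum x N)
    (hh : ∀ c, τ.h c ≤ N) (hvar : ∀ c r, τ.var c r = x r) (χ : Weight σ)
    (hχ : ∀ i < N, χ (x i) = -((Finset.univ.filter fun c => i < τ.h c).card : ℤ)) :
    τ.tabPoly k ∈ highestWeightSpace (coordRep σ k τ.m) χ := by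
  intro g hg
  apply MvPolynomial.funext
  intro c
  change aeval c (coordRep σ k τ.m g (τ.tabPoly k)) = aeval c (weightChar χ g • τ.tabPoly k)
  have hc : c = formCoeff τ.m (formOf c) := (formCoeff_formOf c).symm
  rw [map_smul, smul_eq_mul, hc, coordRep_apply, aeval_formCoeff_coordSubst,
    ← splfPoly_monoPres c, linSubstRep_apply, linSubst_splfPoly, τ.aeval_formCoeff_tabPoly,
    τ.aeval_formCoeff_tabPoly]
  have hg' : IsUpperTriangular g⁻¹ :=
    (mem_borelSubgroup_iff _).mp ((borelSubgroup σ k).inv_mem ((mem_borelSubgroup_iff g).mpr hg))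
  rw [τ.EC_mapForms F hx hh hvar (fun a b hab => hg'.apply_eq_zero hab),
    theta_inv_eq_weightChar τ.h hh hx χ hχ hg]

end TabM

end TableauEval

end Literature.Computability.AlgebraicComplexity

end
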